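import Literature.AlgebraicTopology.SingularHomology.FinitePunctureCohomology
import Literature.AlgebraicTopology.SingularHomology.UniversalCoefficientsField
import HarnessLib

/-!
# Removing a point with an explicit Euclidean neighbourhood does not change `Hᵏ(-; F)` below the top degrees
# (field coefficients; Hatcher 2002, §3.3 p. 231 with §3.1 pp. 203–204)

Topic `Literature/AlgebraicTopology/SingularHomology`; theorems only (no definition, no named fact). Written by the prover seat
`hodge-nonav-prover-Ax` (g18). Field-coefficient, explicit-chart companion of the tree's `FinitePunctureCohomology` (which is stated
over `ℤ` for a space carrying a `ChartedSpace (EuclideanSpace ℝ (Fin d))` instance): here the ambient `M` is any Hausdorff space and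
the removed point `P = i 0` is the centre of a given open embedding `i : ℝᵐ⁺¹ ↪ M` (an explicit chart at ONE point suffices — the form
needed for the Milnor fibre of a Pham–Brieskorn polynomial, charted near the fixed points of an involution by the implicit function
theorem, brick L6-5b of crux K1Q, `Summits/HodgeConjecture/HodgeConjecture/Theses/Q8SymplecticPowers.lean`).

* `isZero_singularHomology_complZero_of_field`, `isZero_singularCohomology_complZero_of_field` — `Hₖ` and `Hᵏ` of `ℝᵐ⁺¹ ∖ {0}` with
  coefficients in a field vanish for `0 < k ≠ m` (`ℝᵐ⁺¹ ∖ {0} ≃ Sᵐ`, Hatcher Cor. 2.14; over a field `Hᵏ ≅ Hom(Hₖ, F)`, Thm. 3.2).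
* **`map_subsetIncl_compl_singleton_injective_of_isOpenEmbedding`** ∕ **`…_surjective_of_isOpenEmbedding`** — for an open embedding
  `i : ℝᵐ⁺¹ → M` into a Hausdorff space, `Hᵏ(M; F) → Hᵏ(M ∖ {i 0}; F)` is injective for `2 ≤ k ≠ m + 1` and surjective for
  `1 ≤ k`, `k ≠ m` (Mayer–Vietoris for `M = (M ∖ {i 0}) ∪ i(ℝᵐ⁺¹)`, the cell contractible, the overlap `≅ ℝᵐ⁺¹ ∖ {0}`).

## References

* [HatcherAT2002] A. Hatcher, Algebraic Topology, CUP 2002, Cor. 2.14, §3.1 Thm. 3.2 and pp. 203–204, §3.3 p. 231.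
-/

noncomputable section

open CategoryTheory Limits Set Topology

namespace Literature.AlgebraicTopology.SingularHomology

variable (F : Type) [Field F]

/-! ### Punctured Euclidean space with field coefficients -/

/-- `Hₖ(ℝᵐ⁺¹ ∖ {0}; F) = 0` for `0 < k ≠ m` (`ℝᵐ⁺¹ ∖ {0} ≃ Sᵐ` on homology, Hatcher Cor. 2.14).
[cite: HatcherAT2002, Cor. 2.14 and proof of Thm. 2.26] -/
theorem isZero_singularHomology_complZero_of_field (m : ℕ) {k : ℕ} (hk : 0 < k) (hkm : k ≠ m) :
    IsZero (singularHomology F F ↥(({0}ᶜ : Set (EuclideanSpace ℝ (Fin (m + 1))))) k) := by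
  haveI := isIso_singularHomology_map_sphereToComplZero F F m k
  exact (isZero_singularHomology_sphere_holds F F hk.ne' hkm).of_iso
    (asIso (singularHomology.map F F (sphereToComplZero m) k)).symm

/-- **`Hᵏ(ℝᵐ⁺¹ ∖ {0}; F) = 0` for `0 < k ≠ m`**, `F` a field (`Hᵏ ≅ Hom_F(Hₖ, F)` by the universal coefficient theorem over a field,
Hatcher Thm. 3.2, and `Hₖ = 0`). [cite: HatcherAT2002, Cor. 2.14 and §3.1 Thm. 3.2] -/
theorem isZero_singularCohomology_complZero_of_field (m : ℕ) {k : ℕ} (hk : 0 < k) (hkm : k ≠ m) :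
    IsZero (singularCohomology F F ↥(({0}ᶜ : Set (EuclideanSpace ℝ (Fin (m + 1))))) k) := by
  haveI : Subsingleton (singularHomology F F ↥(({0}ᶜ : Set (EuclideanSpace ℝ (Fin (m + 1))))) k) :=
    ModuleCat.subsingleton_of_isZero (isZero_singularHomology_complZero_of_field F m hk hkm)
  haveI : Subsingleton (singularCohomology F F ↥(({0}ᶜ : Set (EuclideanSpace ℝ (Fin (m + 1))))) k) :=
    ⟨fun a b => kroneckerPairing_injective_of_field F _ k (LinearMap.ext fun z => by rw [Subsingleton.elim z 0, map_zero, map_zero])⟩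
  exact ModuleCat.isZero_of_subsingleton _

/-! ### Removing the centre of an explicit cell -/

variable {m : ℕ} {M : Type} [TopologicalSpace M] [T2Space M] {i : EuclideanSpace ℝ (Fin (m + 1)) → M}

omit [TopologicalSpace M] [T2Space M] in
/-- `(M ∖ {i 0}) ∪ i(ℝᵐ⁺¹) = M`. [folklore] -/
private theorem compl_union_range_eq : ({i 0}ᶜ : Set M) ∪ range i = univ := by
  refine eq_univ_of_forall fun x ↦ ?_
  by_cases hx : x = i 0
  · exact Or.inr ⟨0, hx.symm⟩
  · exact Or.inl hx

/-- **`Hᵏ(M; F) → Hᵏ(M ∖ {i 0}; F)` is injective for `2 ≤ k ≠ m + 1`**, for an open embedding `i : ℝᵐ⁺¹ → M` into a Hausdorff space: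
Mayer–Vietoris for `M = (M ∖ {i 0}) ∪ i(ℝᵐ⁺¹)` with `Hᵏ⁻¹` of the overlap `≅ ℝᵐ⁺¹ ∖ {0}` zero and the cell contractible.
[cite: HatcherAT2002, §3.1 pp. 203–204 and §3.3 p. 231] -/
theorem map_subsetIncl_compl_singleton_injective_of_isOpenEmbedding (hi : IsOpenEmbedding i) {k : ℕ} (hk : 2 ≤ k)
    (hkd : k ≠ m + 1) : Function.Injective (singularCohomology.map F F (subsetIncl ({i 0}ᶜ : Set M)) k) := by
  obtain ⟨j, rfl⟩ : ∃ j, k = j + 1 := ⟨k - 1, by omega⟩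
  have hZ : IsZero (singularCohomology F F (↥(({i 0}ᶜ : Set M) ∩ range i)) j) :=
    (isZero_singularCohomology_complZero_of_field F m (k := j) (by omega) (by omega)).of_iso
      (singularCohomology.mapIso F F (complZeroHomeomorphInter hi.isEmbedding) j)
  have hB : ∀ c : singularCohomology F F M (j + 1), singularCohomology.map F F (subsetIncl (range i)) (j + 1) c = 0 := fun c ↦ by
    haveI : ContractibleSpace ↥(range i) := hi.isEmbedding.toHomeomorph.contractibleSpace_iff.mp inferInstance
    exact ModuleCat.eq_zero_of_isZero_obj (isZero_singularCohomology_of_contractibleSpace F F (↥(range i)) (Nat.succ_ne_zero j)) _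
  have key : ∀ c : singularCohomology F F M (j + 1),
      singularCohomology.map F F (subsetIncl ({i 0}ᶜ : Set M)) (j + 1) c = 0 → c = 0 :=
    fun c hc ↦ singularCohomology.eq_zero_of_map_subsetIncl_eq_zero F isOpen_compl_singleton hi.isOpen_range compl_union_range_eq
      hZ c hc (hB c)
  intro a b hab
  exact sub_eq_zero.mp (key (a - b) (by rw [map_sub, hab, sub_self]))

/-- **`Hᵏ(M; F) → Hᵏ(M ∖ {i 0}; F)` is surjective for `1 ≤ k ≠ m`**, for an open embedding `i : ℝᵐ⁺¹ → M` into a Hausdorff space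
(Mayer–Vietoris, `Hᵏ` of the overlap `≅ ℝᵐ⁺¹ ∖ {0}` zero). [cite: HatcherAT2002, §3.1 pp. 203–204 and §3.3 p. 231] -/
theorem map_subsetIncl_compl_singleton_surjective_of_isOpenEmbedding (hi : IsOpenEmbedding i) {k : ℕ} (hk : 1 ≤ k) (hkm : k ≠ m) :
    Function.Surjective (singularCohomology.map F F (subsetIncl ({i 0}ᶜ : Set M)) k) := by
  have hZ : IsZero (singularCohomology F F (↥(({i 0}ᶜ : Set M) ∩ range i)) k) :=
    (isZero_singularCohomology_complZero_of_field F m (k := k) (by omega) hkm).of_iso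
      (singularCohomology.mapIso F F (complZeroHomeomorphInter hi.isEmbedding) k)
  intro a
  obtain ⟨c, hc, -⟩ := singularCohomology.exists_map_subsetIncl_eq_of_isZero F isOpen_compl_singleton hi.isOpen_range
    compl_union_range_eq hZ a
  exact ⟨c, hc⟩

/-- **Bijective form in the middle degrees**: `Hᵏ(M; F) → Hᵏ(M ∖ {i 0}; F)` is bijective for `2 ≤ k`, `k ≠ m`, `k ≠ m + 1`
(e.g. `k = 2` in a `4`-manifold, `m = 3`). [cite: HatcherAT2002, §3.3 p. 231] -/
theorem map_subsetIncl_compl_singleton_bijective_of_isOpenEmbedding (hi : IsOpenEmbedding i) {k : ℕ} (hk : 2 ≤ k) (hkm : k ≠ m)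
    (hkd : k ≠ m + 1) : Function.Bijective (singularCohomology.map F F (subsetIncl ({i 0}ᶜ : Set M)) k) :=
  ⟨map_subsetIncl_compl_singleton_injective_of_isOpenEmbedding F hi hk hkd,
    map_subsetIncl_compl_singleton_surjective_of_isOpenEmbedding F hi (by omega) hkm⟩

end Literature.AlgebraicTopology.SingularHomology

end
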